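import Literature.NumberTheory.EllipticCurves.FineSelmerReducibleIsotypicMuRoad
import Summits.BirchSwinnertonDyer.BirchSwinnertonDyer.Theorems.KatoDescentTamePotSupersingularCartanMuRoadFukudaDoorsTprime
import Literature.NumberTheory.IwasawaTheory.ClassGroupPRankSmallRankCriterion
import Literature.NumberTheory.IwasawaTheory.ClassicalMuInvariantOnePrimeProofs
import Literature.NumberTheory.EllipticCurves.DivisionFieldReducibleBorelIndex
import HarnessLib

/-!
# THE TWO-FIELD PER-ROW DOOR of crux M: (A) at `(W, p)` on a reducible row from Iwasawa 1956 / Fukuda / one-layer small rank on the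
# TWO CYCLIC CHARACTER FIELDS `ℚ(χ₁) = ℚ(P)` and `ℚ(χ₂) = ℚ(P′)` alone (route-free helper for crux M = stmt-BirchSwinnertonDyer-19196
# `ReducibleKatoMember`, K9 / K8-t′; seat `bsd-potss-rkm` g38)

WHY.  On a reducible row (`W[p]^{ss} = χ₁ ⊕ χ₂`, `C = 𝔽_p(χ₁)` the stable line, `W[p]/C = 𝔽_p(χ₂)`, `χ₁χ₂ = ω`) the `μ`-input of crux M's
kernel chain is statement (A) of Coates–Sujatha at `(W, p)`.  Generations 33–37 fed it from `μ_p = 0` of the whole BOREL FIELD `ℚ(χ₁, χ₂)`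
(g37: of all its imaginary cyclic subfields).  The ISOTYPIC road of this generation (Literature
`CoatesSujatha2005.conjA_of_reducible_of_classicalMuVanishes_characterFields`: equivariant dévissage + equivariant class-field-theoretic
count + one-dimensional descent) needs only the two cyclic fields
  `K₁ = ℚ̄^{ker χ₁} = ℚ(C) = ℚ(P)`   (`P` a generator of `C` = the kernel of the rational `p`-isogeny `W → W′ = W/C`) and
  `K₂ = ℚ̄^{ker χ₂} = ℚ(P′)`          (`P′` a generator of `W[p]/C ⊂ W′[p]` = the kernel of the dual isogeny `W′ → W`),
both cyclic of degree dividing `p − 1`, exactly one of them imaginary.  This file turns that into the numeric per-row door the record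
lanes instantiate: since `K₁, K₂ ⊆ ℚ(χ₁,χ₂)` and `p ∤ [ℚ(χ₁,χ₂) : ℚ]`, Fukuda's index is `0` for their cyclotomic `ℤ_p`-towers (tree
`CartanMuRoadFukudaDoorsTprime.totallyRamifiedFrom_zero_of_isCyclotomic_of_algHom_normal_of_not_dvd_card`), so each of them may pass
EITHER Iwasawa 1956 (`p ∤ h`, one prime above `p`) OR Fukuda's rank stability at some layer OR the one-layer small-rank test
`rank_p Cl((K_i)_j) < p^j − 1` (conjA-anchor g20's `classicalMuVanishes_of_lt_pow_sub_one`).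

* `classicalMuVanishes_fixedField_of_doors` — `μ_p = 0` for every cyclotomic `ℤ_p`-extension of `ℚ̄^G`, `borelKernel C ≤ G`, from the
  three-way door at `ℚ̄^G`;
* `fineSelmerDual_moduleFinite_of_not_irreducible_of_characterFields_doors` — **THE TWO-FIELD DOOR**: (A) at `(W, p)` from the three-way
  door at `K₁` and at `K₂`;
* `fineSelmerDual_moduleFinite_of_not_irreducible_of_characterFields_iwasawa1956_or_rankOne_le` — the layer-one reading the census
  certifies (Iwasawa 1956 ∨ `rank_p Cl((K_i)₁) ≤ p − 2`).

CENSUS (kit job of this generation, evidence on the item; K8-t′ X3 reducible `r_an = 0` class representatives, `p ≥ 5`, 656 rows): `p = 5`: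
ALL 591 rows pass the two-field door (imaginary field: 504 Iwasawa 1956 + 49 small-rank certified + 38 small-rank under GRH (19 cyclic
quartic CM fields, layer of degree 20); real field: 466 Iwasawa 1956 + 104 `ℚ` itself (rational `5`-torsion) + 15 certified + 6 GRH):
551 rows unconditional, 40 under GRH; `p = 7`: 29/41 (the imaginary sextic alone: 31/41, against 11/41 for g37's all-imaginary-subfields
door); `p = 11`: 6/17 (imaginary field alone 14/17); `p = 17`: 5/7.
HONEST FRAMING.  Theorems only; route-free; closes nothing: crux M stays cite-level over {Fine, H2X⁺, modularity} and — class-wide — the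
`μ = 0` input (`H_IC ⊊ FW` after g37; the two-field road needs `μ_p = 0` for cyclic fields of degree dividing `p − 1`, real or imaginary,
i.e. Ferrero–Washington for two abelian fields per row); no class group is computed in Lean; BSD is proved for no curve.
References: [CoatesSujatha2005] Thm. 3.4, Lemma 3.8, Cor. 3.6; [Wuthrich2014] L. 14; [Lim2017FineSelmer] §3; [DeoRaySujatha2023] §5 L. 5.1;
[Washington1997] §13.3 Prop. 13.22–13.23; [Fukuda1994] Thm. 1; [Greenberg2001IwasawaPastPresent] Prop. 2.1; [Serre1972] §4 (Borel image).
-/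

-- the summit and its single problem are both named `BirchSwinnertonDyer` (registry layout D-0017)
set_option linter.dupNamespace false
set_option autoImplicit false

noncomputable section

open scoped Classical Pointwise NumberField
open Field NumberField IsDedekindDomain IntermediateField WeierstrassCurve
open Literature.NumberTheory.EllipticCurves Literature.NumberTheory.EllipticCurves.GreenbergSelmer
open Literature.NumberTheory.GaloisRepresentations Literature.NumberTheory.IwasawaTheory
open Literature.NumberTheory.EllipticCurves.FineSelmerReducibleIsotypic Literature.NumberTheory.EllipticCurves.CoatesSujatha2005
open Summit.BirchSwinnertonDyer.BirchSwinnertonDyer.Theorems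

namespace Summit.BirchSwinnertonDyer.BirchSwinnertonDyer.Theorems.ReducibleFineSelmerCharacterFields

/-! ## §1 The three-way `μ`-door at a subfield of the Borel field -/

/-- **`μ_p = 0` for the cyclotomic `ℤ_p`-towers of `ℚ̄^G`, `borelKernel C ≤ G`, from the THREE-WAY door at `ℚ̄^G`**: Iwasawa 1956
(`p ∤ #Cl`, exactly one prime above `p`) OR, for every cyclotomic `ℤ_p`-extension, Fukuda's rank stability at some layer OR
`rank_p Cl(F_j) < p^j − 1` at some layer.  `ℚ̄^G ⊆ ℚ(χ₁,χ₂)` and `p ∤ #Gal(ℚ(χ₁,χ₂)/ℚ)` (`[ℚ(χ₁,χ₂):ℚ] ∣ (p−1)²`), so Fukuda's index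
is `0`. [cite: Greenberg2001IwasawaPastPresent, Prop. 2.1 p. 339] [cite: Fukuda1994, Thm. 1 (2), p. 264]
[cite: Washington1997, §13.3 Prop. 13.22 and Prop. 13.23] [cite: Serre1972, §4 (Borel image)] -/
theorem classicalMuVanishes_fixedField_of_doors {p : ℕ} [hp : Fact p.Prime] (W : WeierstrassCurve ℚ) [W.IsElliptic]
    (C : AddSubgroup (W.geomTorsion ((p : ℕ) : ℤ)))
    (hC : ∀ (σ : absoluteGaloisGroup ℚ) (x : W.geomTorsion ((p : ℕ) : ℤ)), x ∈ C → σ • x ∈ C) (h1 : C ≠ ⊥) (h2 : C ≠ ⊤)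
    (G : Subgroup (absoluteGaloisGroup ℚ)) (hNG : W.borelKernel C ≤ G)
    (hdoor : (¬ p ∣ Nat.card (ClassGroup (𝓞 ↥(fixedField G : IntermediateField ℚ (AlgebraicClosure ℚ)))) ∧
        ∃! v : HeightOneSpectrum (𝓞 ↥(fixedField G : IntermediateField ℚ (AlgebraicClosure ℚ))),
          ((p : ℕ) : 𝓞 ↥(fixedField G : IntermediateField ℚ (AlgebraicClosure ℚ))) ∈ v.asIdeal) ∨
      ∀ κF : ZpExtension ↥(fixedField G : IntermediateField ℚ (AlgebraicClosure ℚ)) p, κF.IsCyclotomic →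
        (∃ n : ℕ, classGroupPRank κF (n + 1) = classGroupPRank κF n) ∨ ∃ j : ℕ, classGroupPRank κF j < p ^ j - 1)
    (κF : ZpExtension ↥(fixedField G : IntermediateField ℚ (AlgebraicClosure ℚ)) p) (hκF : κF.IsCyclotomic) :
    ClassicalMuVanishes κF := by
  haveI : NeZero p := ⟨hp.out.ne_zero⟩
  have hNopen : IsOpen (W.borelKernel C : Set (absoluteGaloisGroup ℚ)) := isOpen_borelKernel C
  have hGopen : IsOpen (G : Set (absoluteGaloisGroup ℚ)) := Subgroup.isOpen_mono hNG hNopen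
  haveI : FiniteDimensional ℚ ↥(fixedField G : IntermediateField ℚ (AlgebraicClosure ℚ)) :=
    finiteDimensional_fixedField_of_isOpen G hGopen
  haveI : NumberField ↥(fixedField G : IntermediateField ℚ (AlgebraicClosure ℚ)) := NumberField.mk
  haveI : FiniteDimensional ℚ (W.borelField C) := finiteDimensional_borelField C
  haveI : IsGalois ℚ (W.borelField C) := isGalois_borelField hC
  -- `p ∤ #Gal(ℚ(χ₁,χ₂)/ℚ)`
  have hdeg : ¬ p ∣ Nat.card (↥(W.borelField C) ≃ₐ[ℚ] ↥(W.borelField C)) := by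
    rw [IsGalois.card_aut_eq_finrank]
    intro h
    have hdvd := h.trans (W.finrank_borelField_dvd hC h1 h2)
    have h1' : p ∣ p - 1 := (Nat.Prime.dvd_mul hp.out).mp (by simpa [sq] using hdvd) |>.elim id id
    have h2' := Nat.le_of_dvd (Nat.sub_pos_of_lt hp.out.one_lt) h1'
    have h3' := hp.out.one_lt
    omega
  -- `ℚ̄^G ⊆ ℚ(χ₁,χ₂) = ℚ̄^{borelKernel}`
  have hle : (fixedField G : IntermediateField ℚ (AlgebraicClosure ℚ)) ≤ W.borelField C := by
    rw [borelField_def]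
    exact IntermediateField.fixedField_le hNG
  rcases hdoor with ⟨hh, hv⟩ | hF
  · have hh' : ¬ p ∣ NumberField.classNumber ↥(fixedField G : IntermediateField ℚ (AlgebraicClosure ℚ)) := by
      rwa [NumberField.classNumber, ← Nat.card_eq_fintype_card]
    exact classicalMuVanishes_of_classNumberPExp_eq_zero
      iwasawa1956_classNumberPExp_eq_zero_of_not_dvd_classNumber_of_unique_prime_holds hh' hv κF
  · have hram : TotallyRamifiedFrom κF 0 :=
      CartanMuRoadFukudaDoorsTprime.totallyRamifiedFrom_zero_of_isCyclotomic_of_algHom_normal_of_not_dvd_card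
        ↥(fixedField G : IntermediateField ℚ (AlgebraicClosure ℚ)) (W.borelField C) p hdeg (IntermediateField.inclusion hle) κF hκF
    rcases hF κF hκF with ⟨n, hn⟩ | ⟨j, hj⟩
    · exact classicalMuVanishes_of_classGroupPRank_succ_eq' κF hram (Nat.zero_le n) hn
    · exact classicalMuVanishes_of_lt_pow_sub_one κF hram le_rfl (j := j) (by rwa [zero_add])

/-! ## §2 THE TWO-FIELD DOOR -/

/-- **THE TWO-FIELD PER-ROW DOOR: (A) at `(W, p)` on a reducible row from the three-way door at `ℚ(χ₁) = ℚ(P)` and at `ℚ(χ₂) = ℚ(P′)`.**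
`W/ℚ` elliptic, `p` odd, `κ` the cyclotomic `ℤ_p`-extension, `C ≤ W[p]` a stable line; `K₁ = ℚ̄^{fixingSubgroup C}` (`= ℚ(P)`, `P` a
generator of the `p`-isogeny kernel `C`), `K₂ = ℚ̄^{ker χ₂}` (`ker χ₂` = the fixing subgroup of the cosets of `C`; `= ℚ(P′)`, `P′` a generator
of the dual-isogeny kernel).  If each of `K₁`, `K₂` passes Iwasawa 1956 ∨ (∀ cyclotomic: Fukuda ∨ small rank), then the dual fine Selmer
group of `W` over `ℚ_∞` is finitely generated over `ℤ_p`.  (At `p = 5` for a rational `5`-isogeny with `χ₁ = ψ` odd quadratic: `K₁ = ℚ(√d)`,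
`K₂` the REAL cyclic quartic field `ℚ(ωψ)`.) [cite: CoatesSujatha2005, §3 Thm. 3.4, Lemma 3.8 and Cor. 3.6] [cite: Wuthrich2014, Lemma 14 (p. 396)]
[cite: DeoRaySujatha2023, §5 Lemma 5.1] [cite: Greenberg2001IwasawaPastPresent, Prop. 2.1 p. 339] [cite: Washington1997, §13.3 Prop. 13.23] -/
theorem fineSelmerDual_moduleFinite_of_not_irreducible_of_characterFields_doors {p : ℕ} [hp : Fact p.Prime] (hp2 : p ≠ 2)
    (W : WeierstrassCurve ℚ) [W.IsElliptic] (κ : ZpExtension ℚ p) (hκ : κ.IsCyclotomic)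
    (C : AddSubgroup (W.geomTorsion ((p : ℕ) : ℤ)))
    (hC : ∀ (σ : absoluteGaloisGroup ℚ) (x : W.geomTorsion ((p : ℕ) : ℤ)), x ∈ C → σ • x ∈ C) (h1 : C ≠ ⊥) (h2 : C ≠ ⊤)
    (hK₁ : (¬ p ∣ Nat.card (ClassGroup (𝓞 ↥(fixedField (fixingSubgroup (absoluteGaloisGroup ℚ)
          (C : Set (W.geomTorsion ((p : ℕ) : ℤ)))) : IntermediateField ℚ (AlgebraicClosure ℚ)))) ∧
        ∃! v : HeightOneSpectrum (𝓞 ↥(fixedField (fixingSubgroup (absoluteGaloisGroup ℚ)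
          (C : Set (W.geomTorsion ((p : ℕ) : ℤ)))) : IntermediateField ℚ (AlgebraicClosure ℚ))),
          ((p : ℕ) : 𝓞 ↥(fixedField (fixingSubgroup (absoluteGaloisGroup ℚ)
            (C : Set (W.geomTorsion ((p : ℕ) : ℤ)))) : IntermediateField ℚ (AlgebraicClosure ℚ))) ∈ v.asIdeal) ∨
      ∀ κ₁ : ZpExtension ↥(fixedField (fixingSubgroup (absoluteGaloisGroup ℚ)
          (C : Set (W.geomTorsion ((p : ℕ) : ℤ)))) : IntermediateField ℚ (AlgebraicClosure ℚ)) p, κ₁.IsCyclotomic →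
        (∃ n : ℕ, classGroupPRank κ₁ (n + 1) = classGroupPRank κ₁ n) ∨ ∃ j : ℕ, classGroupPRank κ₁ j < p ^ j - 1)
    (hK₂ : (¬ p ∣ Nat.card (ClassGroup (𝓞 ↥(fixedField (fixingSubgroup (absoluteGaloisGroup ℚ)
          (Set.range fun y : W.geomTorsion ((p : ℕ) : ℤ) => y +ᵥ (C : Set (W.geomTorsion ((p : ℕ) : ℤ))))) :
            IntermediateField ℚ (AlgebraicClosure ℚ)))) ∧
        ∃! v : HeightOneSpectrum (𝓞 ↥(fixedField (fixingSubgroup (absoluteGaloisGroup ℚ)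
          (Set.range fun y : W.geomTorsion ((p : ℕ) : ℤ) => y +ᵥ (C : Set (W.geomTorsion ((p : ℕ) : ℤ))))) :
            IntermediateField ℚ (AlgebraicClosure ℚ))),
          ((p : ℕ) : 𝓞 ↥(fixedField (fixingSubgroup (absoluteGaloisGroup ℚ)
            (Set.range fun y : W.geomTorsion ((p : ℕ) : ℤ) => y +ᵥ (C : Set (W.geomTorsion ((p : ℕ) : ℤ))))) :
              IntermediateField ℚ (AlgebraicClosure ℚ))) ∈ v.asIdeal) ∨
      ∀ κ₂ : ZpExtension ↥(fixedField (fixingSubgroup (absoluteGaloisGroup ℚ)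
          (Set.range fun y : W.geomTorsion ((p : ℕ) : ℤ) => y +ᵥ (C : Set (W.geomTorsion ((p : ℕ) : ℤ))))) :
            IntermediateField ℚ (AlgebraicClosure ℚ)) p, κ₂.IsCyclotomic →
        (∃ n : ℕ, classGroupPRank κ₂ (n + 1) = classGroupPRank κ₂ n) ∨ ∃ j : ℕ, classGroupPRank κ₂ j < p ^ j - 1) :
    ∃ (γ : absoluteGaloisGroup ℚ) (D : W.FineSelmerDualData κ γ),
      Module.Finite ℤ_[p] (RestrictScalars ℤ_[p] (IwasawaAlgebra p) D.X) :=
  conjA_of_reducible_of_classicalMuVanishes_characterFields W hp2 C hC h1 h2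
    (classicalMuVanishes_fixedField_of_doors W C hC h1 h2 _ borelKernel_le_fixingSubgroup_coe hK₁)
    (classicalMuVanishes_fixedField_of_doors W C hC h1 h2 _ (borelKernel_le_fixingSubgroup_cosets hC) hK₂) κ hκ

/-! ## §3 The layer-one reading certified by the census: Iwasawa 1956 ∨ `rank_p Cl((K_i)₁) ≤ p − 2` -/

/-- **THE TWO-FIELD DOOR, LAYER-ONE READING: (A) at `(W, p)` when each of `ℚ(P)`, `ℚ(P′)` passes Iwasawa 1956 OR has
`rank_p Cl(K₁) ≤ p − 2` at the first layer of every cyclotomic `ℤ_p`-extension** (`K_1 = K·ℚ₁`, `ℚ₁` the degree-`p` subfield of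
`ℚ(ζ_{p²})`).  `p = 5`: `rank₅ ≤ 3` — with Iwasawa 1956 this covers all 591 K8-t′ X3 reducible rows (551 unconditionally, 40 under GRH for the
degree-`20` layer of 19 cyclic quartic CM fields and 4 real quartics). [cite: Washington1997, §13.3 Prop. 13.23]
[cite: Greenberg2001IwasawaPastPresent, Prop. 2.1 p. 339] [cite: CoatesSujatha2005, §3 Cor. 3.6] -/
theorem fineSelmerDual_moduleFinite_of_not_irreducible_of_characterFields_iwasawa1956_or_rankOne_le {p : ℕ} [hp : Fact p.Prime]
    (hp2 : p ≠ 2) (W : WeierstrassCurve ℚ) [W.IsElliptic] (κ : ZpExtension ℚ p) (hκ : κ.IsCyclotomic)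
    (C : AddSubgroup (W.geomTorsion ((p : ℕ) : ℤ)))
    (hC : ∀ (σ : absoluteGaloisGroup ℚ) (x : W.geomTorsion ((p : ℕ) : ℤ)), x ∈ C → σ • x ∈ C) (h1 : C ≠ ⊥) (h2 : C ≠ ⊤)
    (hK₁ : (¬ p ∣ Nat.card (ClassGroup (𝓞 ↥(fixedField (fixingSubgroup (absoluteGaloisGroup ℚ)
          (C : Set (W.geomTorsion ((p : ℕ) : ℤ)))) : IntermediateField ℚ (AlgebraicClosure ℚ)))) ∧
        ∃! v : HeightOneSpectrum (𝓞 ↥(fixedField (fixingSubgroup (absoluteGaloisGroup ℚ)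
          (C : Set (W.geomTorsion ((p : ℕ) : ℤ)))) : IntermediateField ℚ (AlgebraicClosure ℚ))),
          ((p : ℕ) : 𝓞 ↥(fixedField (fixingSubgroup (absoluteGaloisGroup ℚ)
            (C : Set (W.geomTorsion ((p : ℕ) : ℤ)))) : IntermediateField ℚ (AlgebraicClosure ℚ))) ∈ v.asIdeal) ∨
      ∀ κ₁ : ZpExtension ↥(fixedField (fixingSubgroup (absoluteGaloisGroup ℚ)
          (C : Set (W.geomTorsion ((p : ℕ) : ℤ)))) : IntermediateField ℚ (AlgebraicClosure ℚ)) p, κ₁.IsCyclotomic →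
        classGroupPRank κ₁ 1 ≤ p - 2)
    (hK₂ : (¬ p ∣ Nat.card (ClassGroup (𝓞 ↥(fixedField (fixingSubgroup (absoluteGaloisGroup ℚ)
          (Set.range fun y : W.geomTorsion ((p : ℕ) : ℤ) => y +ᵥ (C : Set (W.geomTorsion ((p : ℕ) : ℤ))))) :
            IntermediateField ℚ (AlgebraicClosure ℚ)))) ∧
        ∃! v : HeightOneSpectrum (𝓞 ↥(fixedField (fixingSubgroup (absoluteGaloisGroup ℚ)
          (Set.range fun y : W.geomTorsion ((p : ℕ) : ℤ) => y +ᵥ (C : Set (W.geomTorsion ((p : ℕ) : ℤ))))) :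
            IntermediateField ℚ (AlgebraicClosure ℚ))),
          ((p : ℕ) : 𝓞 ↥(fixedField (fixingSubgroup (absoluteGaloisGroup ℚ)
            (Set.range fun y : W.geomTorsion ((p : ℕ) : ℤ) => y +ᵥ (C : Set (W.geomTorsion ((p : ℕ) : ℤ))))) :
              IntermediateField ℚ (AlgebraicClosure ℚ))) ∈ v.asIdeal) ∨
      ∀ κ₂ : ZpExtension ↥(fixedField (fixingSubgroup (absoluteGaloisGroup ℚ)
          (Set.range fun y : W.geomTorsion ((p : ℕ) : ℤ) => y +ᵥ (C : Set (W.geomTorsion ((p : ℕ) : ℤ))))) :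
            IntermediateField ℚ (AlgebraicClosure ℚ)) p, κ₂.IsCyclotomic → classGroupPRank κ₂ 1 ≤ p - 2) :
    ∃ (γ : absoluteGaloisGroup ℚ) (D : W.FineSelmerDualData κ γ),
      Module.Finite ℤ_[p] (RestrictScalars ℤ_[p] (IwasawaAlgebra p) D.X) := by
  have hp2' : 2 ≤ p := hp.out.two_le
  refine fineSelmerDual_moduleFinite_of_not_irreducible_of_characterFields_doors hp2 W κ hκ C hC h1 h2 ?_ ?_
  · rcases hK₁ with h | h
    · exact Or.inl h
    · refine Or.inr fun κ₁ hκ₁ => Or.inr ⟨1, ?_⟩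
      have := h κ₁ hκ₁
      rw [pow_one]
      omega
  · rcases hK₂ with h | h
    · exact Or.inl h
    · refine Or.inr fun κ₂ hκ₂ => Or.inr ⟨1, ?_⟩
      have := h κ₂ hκ₂
      rw [pow_one]
      omega

end Summit.BirchSwinnertonDyer.BirchSwinnertonDyer.Theorems.ReducibleFineSelmerCharacterFields

end
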